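import Summits.BirchSwinnertonDyer.BirchSwinnertonDyer.Theses.PAdicOrderV2
import Summits.BirchSwinnertonDyer.BirchSwinnertonDyer.Theorems.LeadingTermPinchPrimePinchAtOfSamePrime
import Summits.BirchSwinnertonDyer.BirchSwinnertonDyer.Theorems.PAdicOrderV2PAdicOrderThesisR2JetCongruence
import Literature.NumberTheory.EllipticCurves.CanonicalPAdicHeightHolds
import Literature.NumberTheory.EllipticCurves.CanonicalPAdicHeightAdmissibleProofs
import Literature.NumberTheory.EllipticCurves.CyclotomicPAdicHeight
import Literature.NumberTheory.EllipticCurves.OrdinaryPrimesProofs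
import Literature.NumberTheory.EllipticCurves.MordellWeilTheoremProofs
import Literature.Barriers.BirchSwinnertonDyer.PAdicHeightNondegeneracyProofs

/-!
# BirchSwinnertonDyer / PAdicOrderV2 — crux `PAdicOrderThesisR2` (stmt-0487), line
# `lambda-adic-gz-square-class`: TIGHTNESS of stub S″ (`stub_rankOne_schneiderPrime`)

Stub S″ of the line (= hypothesis (S″) of LeadingTerm's landed `stub_pinchAt_of_samePrime`, = the
`∃p`-weakening of crux #5 `PAdicOrderRankOneR4`): every non-CM elliptic `E/ℚ` (globally minimal
`W`) of analytic rank `1` has ONE good ordinary prime `p ≥ 5` with `E[p]` irreducible at which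
every CANONICAL cyclotomic `p`-adic height datum is non-degenerate (`Reg_p ≠ 0`).

This file reduces S″ to its arithmetic core, kernel-checked (wave-1 audit of the lead seat a2,
worker `stub_rankOne_schneiderPrime`, nothing assumed beyond tree theorems except where GZK is an
explicit hypothesis):

* `exists_ordinary_irreducible_existsUnique_isCanonical`: the `∃`-prefix of S″ is satisfiable for
  EVERY curve — a prime `p ≥ 5`, good ordinary, `E[p]` irreducible (cofinitely many:
  `exists_forall_hasIrreducibleModPGaloisRep_of_lt`, `exists_goodOrdinary_five_le_not_mem`), with a
  UNIQUE canonical datum (`existsUnique_isCanonical_holds`). So the only content of S″ is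
  `Reg_p ≠ 0` at such a prime.
* `schneiderClause_iff_exists_admissible_ne_zero` / `…_forall_…`: in Mordell–Weil rank `1`, at a
  good ordinary `p ≥ 5`, "every canonical datum satisfies Schneider" ⟺ "SOME admissible point has
  `ĥ_p ≠ 0`" ⟺ "EVERY admissible point has `ĥ_p ≠ 0`" (canonical data are unique and pinned on
  admissible points; `not_schneiderConjecture_iff_of_rank_one`, `pairing_eq_zero_of_rank_one` of
  the barrier file `PAdicHeightNondegeneracyProofs`; admissible multiples exist).
* `rankOne_schneiderPrime_iff_heightWitness` (registered helper): the Mordell–Weil-rank-1 form of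
  S″ is EQUIVALENT to "every non-CM curve of Mordell–Weil rank 1 has, at some good ordinary
  irreducible `p ≥ 5`, an admissible point with `ĥ_p(P) ≠ 0`" — a height-non-Wieferich-type
  statement (cf. the jet congruence `jetCongruence`, p144815: `ĥ_p(P) ≡ log_p(num x(P))`).
* `stub_rankOne_schneiderPrime_of_GZK_heightWitness` (registered helper): Gross–Zagier–Kolyvagin
  (named fact `rank_eq_analyticRank_of_analyticRank_le_one`, unproved — conjunct 4 of stub F) plus
  that witness statement give S″ VERBATIM.

So S″ = GZK + "one visible (height-non-Wieferich) ordinary irreducible prime per non-CM rank-1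
curve" — exactly the open transferred crux NW of the dead line `wieferich-jet`, sharpened by
irreducibility at the witness prime. Mazur–Stein–Tate 2006, Conj. 1.1 and §4.
-/

-- single-conjunct summit: `Summit.BirchSwinnertonDyer.BirchSwinnertonDyer.…` repeats the name by design
set_option linter.dupNamespace false

noncomputable section

namespace Summit.BirchSwinnertonDyer.BirchSwinnertonDyer.Cruxes.PAdicOrderThesisR2.LambdaAdicGZ

open Literature.NumberTheory.EllipticCurves Literature.NumberTheory.EllipticCurves.ModularForms
open WeierstrassCurve

/-- **The `∃`-prefix of S″ is satisfiable for every curve**: a prime `p ≥ 5` of good ordinary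
reduction with `E[p]` irreducible and a UNIQUE canonical `p`-adic height datum (irreducibility
for all large `p`, Serre/Mazur, tree theorem `exists_forall_hasIrreducibleModPGaloisRep_of_lt`;
good ordinary primes `≥ 5` outside any finite set, `exists_goodOrdinary_five_le_not_mem`;
`existsUnique_isCanonical_holds`). [cite: MazurSteinTate2006, §1] -/
theorem exists_ordinary_irreducible_existsUnique_isCanonical (W : WeierstrassCurve ℚ)
    [W.IsElliptic] [W.IsGloballyMinimal] :
    ∃ (p : ℕ) (_ : Fact p.Prime), 5 ≤ p ∧ IsOrdinaryAt W p ∧ W.HasIrreducibleModPGaloisRep p ∧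
      ∃! Dh : PAdicHeightData W p, Dh.IsCanonical := by
  obtain ⟨N, hN⟩ := W.exists_forall_hasIrreducibleModPGaloisRep_of_lt
  obtain ⟨p, hpB, hp, h5, hord⟩ :=
    Cruxes.PinchPrime.FirstLayerStability.exists_goodOrdinary_five_le_not_mem W (Finset.range (N + 1))
  have hpN : N < p := by
    have : ¬ p < N + 1 := fun h ↦ hpB (Finset.mem_range.mpr h)
    omega
  haveI : Fact p.Prime := hp
  exact ⟨p, hp, h5, hord, hN p hpN hp.out,
    WeierstrassCurve.existsUnique_isCanonical_holds W p h5 hord.1 hord.2⟩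

section RankOne

variable {W : WeierstrassCurve ℚ} {p : ℕ} [Fact p.Prime]

/-- **Rank one: the Schneider clause of S″ at `p` is EQUIVALENT to one admissible point with
`ĥ_p ≠ 0`.** For `W` globally minimal of Mordell–Weil rank `1` and `p ≥ 5` good ordinary:
(∀ canonical `Dh`, `Reg_p(E, Dh) ≠ 0`) ↔ ∃ admissible `P` with `ĥ_p(P) ≠ 0`. Inputs (all proved
in the tree): existence of the canonical datum, admissible multiples of non-torsion points,
`not_schneiderConjecture_of_rank_one` / `not_schneiderConjecture_iff_of_rank_one` /
`pairing_eq_zero_of_rank_one`. [cite: MazurSteinTate2006, Conj. 1.1] -/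
theorem schneiderClause_iff_exists_admissible_ne_zero [W.IsElliptic] [W.IsGloballyMinimal]
    (h5 : 5 ≤ p) (hO : IsOrdinaryAt W p) (hr : W.mordellWeilRank = 1) :
    (∀ Dh : PAdicHeightData W p, Dh.IsCanonical → SchneiderConjecture Dh) ↔
      ∃ P : W.toAffine.Point, W.IsAdmissible p P ∧ W.canonicalPAdicHeight p P ≠ 0 := by
  obtain ⟨D, hD⟩ := WeierstrassCurve.exists_isCanonical_holds W p h5 hO.1 hO.2
  have hMW : W.exists_isMordellWeilBasis := WeierstrassCurve.exists_isMordellWeilBasis_holds W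
  constructor
  · intro hS
    obtain ⟨P₀, hP₀⟩ := WieferichJet.exists_not_isOfFinAddOrder_of_one_le_mordellWeilRank W hr.ge
    obtain ⟨m, -, hadm⟩ := WeierstrassCurve.exists_admissible_nsmul_holds W p P₀ hP₀
    refine ⟨m • P₀, hadm, ?_⟩
    rw [← hD _ hadm]
    intro h0
    exact (D.not_schneiderConjecture_of_rank_one hr hadm.1 h0) (hS D hD)
  · rintro ⟨P, hP, hne⟩ Dh hDh
    by_contra hS
    obtain ⟨P₁, hP₁, h0⟩ := (Dh.not_schneiderConjecture_iff_of_rank_one hr hMW).mp hS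
    exact hne ((hDh P hP).symm.trans (Dh.pairing_eq_zero_of_rank_one hr hP₁ h0 P P))

/-- Pointwise form: in Mordell–Weil rank one, at `p ≥ 5` good ordinary, the Schneider clause of
S″ at `p` ↔ `ĥ_p ≠ 0` at EVERY admissible point. [cite: MazurSteinTate2006, Conj. 1.1] -/
theorem schneiderClause_iff_forall_admissible_ne_zero [W.IsElliptic] [W.IsGloballyMinimal]
    (h5 : 5 ≤ p) (hO : IsOrdinaryAt W p) (hr : W.mordellWeilRank = 1) :
    (∀ Dh : PAdicHeightData W p, Dh.IsCanonical → SchneiderConjecture Dh) ↔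
      ∀ P : W.toAffine.Point, W.IsAdmissible p P → W.canonicalPAdicHeight p P ≠ 0 := by
  obtain ⟨D, hD⟩ := WeierstrassCurve.exists_isCanonical_holds W p h5 hO.1 hO.2
  constructor
  · intro hS P hP h0
    rw [← hD P hP] at h0
    exact (D.not_schneiderConjecture_of_rank_one hr hP.1 h0) (hS D hD)
  · intro hall
    obtain ⟨P₀, hP₀⟩ := WieferichJet.exists_not_isOfFinAddOrder_of_one_le_mordellWeilRank W hr.ge
    obtain ⟨m, -, hadm⟩ := WeierstrassCurve.exists_admissible_nsmul_holds W p P₀ hP₀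
    exact (schneiderClause_iff_exists_admissible_ne_zero h5 hO hr).mpr ⟨_, hadm, hall _ hadm⟩

end RankOne

/-- **Tightness of S″ (Mordell–Weil-rank form), registered helper.** "Every non-CM curve of
Mordell–Weil rank `1` has a good ordinary irreducible prime `p ≥ 5` at which every canonical
datum satisfies Schneider" is EQUIVALENT to "every non-CM curve of Mordell–Weil rank `1` has a
good ordinary irreducible prime `p ≥ 5` and an admissible point `P` with `ĥ_p(P) ≠ 0`" — a
height-non-Wieferich-type statement at ONE prime (cf. `jetCongruence`, p144815).
[cite: MazurSteinTate2006, Conj. 1.1] -/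
theorem rankOne_schneiderPrime_iff_heightWitness :
    (∀ (W : WeierstrassCurve ℚ) [W.IsElliptic] [W.IsGloballyMinimal], W.mordellWeilRank = 1 →
      ¬ W.HasCM →
      ∃ (p : ℕ) (_ : Fact p.Prime), 5 ≤ p ∧ IsOrdinaryAt W p ∧ W.HasIrreducibleModPGaloisRep p ∧
        ∀ Dh : WeierstrassCurve.PAdicHeightData W p, Dh.IsCanonical →
          WeierstrassCurve.SchneiderConjecture Dh) ↔
    (∀ (W : WeierstrassCurve ℚ) [W.IsElliptic] [W.IsGloballyMinimal], W.mordellWeilRank = 1 →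
      ¬ W.HasCM →
      ∃ (p : ℕ) (_ : Fact p.Prime), 5 ≤ p ∧ IsOrdinaryAt W p ∧ W.HasIrreducibleModPGaloisRep p ∧
        ∃ P : W.toAffine.Point, W.IsAdmissible p P ∧ W.canonicalPAdicHeight p P ≠ 0) := by
  constructor
  · intro h W _ _ hr hCM
    obtain ⟨p, hp, h5, hO, hirr, hS⟩ := h W hr hCM
    exact ⟨p, hp, h5, hO, hirr, (schneiderClause_iff_exists_admissible_ne_zero h5 hO hr).mp hS⟩
  · intro h W _ _ hr hCM
    obtain ⟨p, hp, h5, hO, hirr, hP⟩ := h W hr hCM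
    exact ⟨p, hp, h5, hO, hirr, (schneiderClause_iff_exists_admissible_ne_zero h5 hO hr).mpr hP⟩

/-- **S″ from Gross–Zagier–Kolyvagin and one height witness per curve, registered helper.**
GZK (`rank_eq_analyticRank_of_analyticRank_le_one`, named fact, conjunct 4 of stub F; it turns
`r_an = 1` into `r_MW = 1`) and "every non-CM curve of Mordell–Weil rank `1` has an admissible
point with `ĥ_p ≠ 0` at some good ordinary irreducible `p ≥ 5`" imply
`stub_rankOne_schneiderPrime` VERBATIM. So S″ = GZK + the (irreducibility-sharpened) transferred
crux NW of the dead line `wieferich-jet`. [cite: MazurSteinTate2006, Conj. 1.1] -/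
theorem stub_rankOne_schneiderPrime_of_GZK_heightWitness :
    rank_eq_analyticRank_of_analyticRank_le_one →
    (∀ (W : WeierstrassCurve ℚ) [W.IsElliptic] [W.IsGloballyMinimal], W.mordellWeilRank = 1 →
      ¬ W.HasCM →
      ∃ (p : ℕ) (_ : Fact p.Prime), 5 ≤ p ∧ IsOrdinaryAt W p ∧ W.HasIrreducibleModPGaloisRep p ∧
        ∃ P : W.toAffine.Point, W.IsAdmissible p P ∧ W.canonicalPAdicHeight p P ≠ 0) →
    ∀ (W : WeierstrassCurve ℚ) [W.IsElliptic] [W.IsGloballyMinimal], W.analyticRank = 1 →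
      ¬ W.HasCM →
      ∃ (p : ℕ) (_ : Fact p.Prime), 5 ≤ p ∧ IsOrdinaryAt W p ∧ W.HasIrreducibleModPGaloisRep p ∧
        ∀ Dh : WeierstrassCurve.PAdicHeightData W p, Dh.IsCanonical →
          WeierstrassCurve.SchneiderConjecture Dh := by
  intro hGZK hW W _ _ h1 hCM
  have hr : W.mordellWeilRank = 1 := by rw [(hGZK W (by omega)).1, h1]
  exact rankOne_schneiderPrime_iff_heightWitness.mpr hW W hr hCM

end Summit.BirchSwinnertonDyer.BirchSwinnertonDyer.Cruxes.PAdicOrderThesisR2.LambdaAdicGZ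

end
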